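import Mathlib.Analysis.Calculus.Deriv.Star
import Mathlib.Analysis.Complex.CauchyIntegral
import Mathlib.Analysis.Complex.HasPrimitives
import Mathlib.Analysis.SpecialFunctions.Complex.Analytic
import Mathlib.Analysis.SpecialFunctions.Gamma.Beta
import Mathlib.MeasureTheory.Integral.IntervalIntegral.FundThmCalculus
import Literature.NumberTheory.LFunctions.RiemannSiegel
import HarnessLib

/-!
# Discharged facts: parity and differentiability of the Riemann–Siegel theta function

`Literature.NumberTheory.LFunctions.RiemannSiegel` defines
`θ(t) = ∫₀ᵗ θ'(u) du`, `θ'(u) = Re ψ(1/4 + iu/2)/2 − (log π)/2`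
(`ψ = Γ'/Γ = Complex.digamma`)
and Hardy's `Z(t) = Re (e^{iθ(t)} ζ(1/2 + it))`, and records their elementary API as named
facts (`def … : Prop`). Six of them are proved here, so that users holding
`(h : riemannSiegelTheta_neg)` etc. can discharge the hypothesis by `riemannSiegelTheta_neg_holds`:

* `riemannSiegelThetaDeriv_neg_holds` — `θ'` is even, from `ψ(s̄) = conj ψ(s)`
  (`Complex.digamma_conj`, itself from `Complex.Gamma_conj` and `deriv_conj_conj`);
* `riemannSiegelTheta_neg_holds` — `θ` is odd (substitute `u ↦ -u` in the defining integral);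
* `continuous_riemannSiegelThetaDeriv_holds` — `θ'` is continuous (`Γ` is analytic on the open
  right half-plane and has no zeros there, so `ψ = Γ'/Γ` is continuous there);
* `hasDerivAt_riemannSiegelTheta_holds` — `θ' = dθ/dt` (fundamental theorem of calculus);
* `hardyZ_neg_holds` — `Z` is even, from `θ` odd and `ζ(s̄) = conj ζ(s)` (`riemannZeta_conj`).
* `contDiff_riemannSiegelTheta_holds` — `θ` is `C^n` for every `n : WithTop ℕ∞`, `ω` included:
  `θ` is real-analytic (`analyticAt_riemannSiegelTheta`). On each disc `|s − t₀| < 1/2` the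
  holomorphic extension `G(s) = ψ(1/4 + is/2)/2 − (log π)/2` of `θ'` has a primitive `F`
  (Mathlib `DifferentiableOn.isExactOn_ball`); `θ` and `t ↦ Re F(t)` have the same derivative on
  `(t₀ − 1/2, t₀ + 1/2)` and the same value at `t₀`, so they agree there, and the real trace of a
  holomorphic function is real-analytic (`AnalyticAt.re_ofReal`).

The phase identity `e^{iθ} = π^{-it/2} Γ(1/4+it/2)/|Γ(1/4+it/2)|`, the reality of
`e^{iθ} ζ(1/2+it)` (functional equation) and the facts depending on them are proved in
`RiemannSiegelPhase.lean`; the Stirling expansion and `S(T) = O(log T)` remain named facts. The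
proofs live in a separate file because `RiemannSiegel.lean` is a definitions file with
migration-only `[cite pending]` tags.

## References

* H. M. Edwards, *Riemann's Zeta Function*, Academic Press (1974), §6.5.
* E. C. Titchmarsh, *The Theory of the Riemann Zeta-Function*, 2nd ed. (1986), §4.17.
-/

noncomputable section

open Complex Filter Set Metric
open scoped Real Topology ComplexConjugate

namespace Literature.NumberTheory.LFunctions

/-! ## Conjugation symmetry and continuity of `ψ = Γ'/Γ` -/

/-- `Γ` commutes with complex conjugation, as an identity of functions:
`conj ∘ Γ ∘ conj = Γ` (`Complex.Gamma_conj`). [folklore] -/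
theorem conj_comp_Gamma_comp_conj : (conj ∘ Complex.Gamma ∘ conj) = Complex.Gamma := by
  funext s
  simp [Complex.Gamma_conj]

/-- `Γ'(s̄) = conj Γ'(s)`: the derivative of a conjugation-symmetric function is conjugation
symmetric (`deriv_conj_conj`). [folklore] -/
theorem deriv_Gamma_conj (s : ℂ) :
    deriv Complex.Gamma (conj s) = conj (deriv Complex.Gamma s) := by
  have h := congr_fun (deriv_conj_conj (f := Complex.Gamma)) (conj s)
  rw [conj_comp_Gamma_comp_conj] at h
  simpa using h

/-- The digamma function is conjugation symmetric: `ψ(s̄) = conj ψ(s)` (Edwards §6.5, used for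
the parity of `θ`). [folklore] -/
theorem digamma_conj (s : ℂ) : Complex.digamma (conj s) = conj (Complex.digamma s) := by
  rw [Complex.digamma_def, logDeriv_apply, logDeriv_apply, Complex.Gamma_conj, deriv_Gamma_conj,
    map_div₀]

/-- `Γ` is analytic at every point of the open right half-plane. [folklore] -/
theorem analyticAt_Gamma_of_re_pos {s : ℂ} (hs : 0 < s.re) : AnalyticAt ℂ Complex.Gamma s := by
  have hopen : IsOpen {z : ℂ | 0 < z.re} := isOpen_lt continuous_const Complex.continuous_re
  have hdiff : DifferentiableOn ℂ Complex.Gamma {z : ℂ | 0 < z.re} := by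
    intro z hz
    refine (Complex.differentiableAt_Gamma z fun m hm => ?_).differentiableWithinAt
    have : z.re = -m := by rw [hm]; simp
    simp only [Set.mem_setOf_eq, this] at hz
    linarith [(Nat.cast_nonneg m : (0 : ℝ) ≤ m)]
  exact hdiff.analyticOnNhd hopen s hs

/-- `ψ = Γ'/Γ` is continuous at every point of the open right half-plane (`Γ` analytic and
zero-free there). [folklore] -/
theorem continuousAt_digamma_of_re_pos {s : ℂ} (hs : 0 < s.re) :
    ContinuousAt Complex.digamma s := by
  have han := analyticAt_Gamma_of_re_pos hs
  rw [Complex.digamma_def]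
  change ContinuousAt (fun z => deriv Complex.Gamma z / Complex.Gamma z) s
  exact han.deriv.continuousAt.div han.continuousAt (Complex.Gamma_ne_zero_of_re_pos hs)

/-! ## Discharges -/

/-- The argument `1/4 + i(-u)/2` is the conjugate of `1/4 + iu/2`. [folklore] -/
theorem quarter_add_neg_mul_I (u : ℝ) :
    (1 / 4 + ((-u : ℝ) : ℂ) / 2 * I) = conj (1 / 4 + (u : ℂ) / 2 * I) := by
  simp only [map_add, map_div₀, map_mul, Complex.conj_ofReal, Complex.conj_I, map_one,
    map_ofNat]
  push_cast
  ring

/-- Discharge of the named fact `riemannSiegelThetaDeriv_neg`: `θ'(-u) = θ'(u)`, since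
`Re ψ(s̄) = Re ψ(s)`. [folklore] -/
theorem riemannSiegelThetaDeriv_neg_holds : riemannSiegelThetaDeriv_neg := by
  intro u
  unfold riemannSiegelThetaDeriv
  rw [quarter_add_neg_mul_I, digamma_conj, Complex.conj_re]

/-- Discharge of the named fact `riemannSiegelTheta_neg`: `θ(-t) = -θ(t)` (substitute `u ↦ -u`
in `∫₀^{-t} θ'` and use that `θ'` is even). [folklore] -/
theorem riemannSiegelTheta_neg_holds : riemannSiegelTheta_neg := by
  intro t
  unfold riemannSiegelTheta
  calc ∫ u in (0 : ℝ)..-t, riemannSiegelThetaDeriv u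
      = ∫ u in (0 : ℝ)..-t, riemannSiegelThetaDeriv (-u) :=
        intervalIntegral.integral_congr fun u _ => (riemannSiegelThetaDeriv_neg_holds u).symm
    _ = ∫ u in t..0, riemannSiegelThetaDeriv u := by
        rw [intervalIntegral.integral_comp_neg]; simp
    _ = -∫ u in (0 : ℝ)..t, riemannSiegelThetaDeriv u := intervalIntegral.integral_symm _ _

/-- Discharge of the named fact `continuous_riemannSiegelThetaDeriv`: `θ'` is continuous, as
`u ↦ 1/4 + iu/2` is continuous with values in the open right half-plane, where `ψ` is
continuous. [folklore] -/
theorem continuous_riemannSiegelThetaDeriv_holds : continuous_riemannSiegelThetaDeriv := by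
  unfold continuous_riemannSiegelThetaDeriv
  have hc : Continuous fun u : ℝ => Complex.digamma (1 / 4 + (u : ℂ) / 2 * I) := by
    refine continuous_iff_continuousAt.2 fun u => ?_
    refine (continuousAt_digamma_of_re_pos ?_).comp ?_
    · simp
    · exact (by fun_prop :
        Continuous fun u : ℝ => (1 / 4 : ℂ) + (u : ℂ) / 2 * I).continuousAt
  have : riemannSiegelThetaDeriv =
      fun u : ℝ => (Complex.digamma (1 / 4 + (u : ℂ) / 2 * I)).re / 2 - Real.log π / 2 := rfl
  rw [this]
  exact ((Complex.continuous_re.comp hc).div_const _).sub continuous_const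

/-- Discharge of the named fact `hasDerivAt_riemannSiegelTheta`: `dθ/dt = θ'` (fundamental
theorem of calculus for the continuous integrand `θ'`). [folklore] -/
theorem hasDerivAt_riemannSiegelTheta_holds : hasDerivAt_riemannSiegelTheta := fun t =>
  (continuous_riemannSiegelThetaDeriv_holds.integral_hasStrictDerivAt 0 t).hasDerivAt

/-- Discharge of the named fact `hardyZ_neg`: `Z(-t) = Z(t)`, since `θ` is odd and
`ζ(s̄) = conj ζ(s)`, so `e^{iθ(-t)} ζ(1/2 - it) = conj (e^{iθ(t)} ζ(1/2 + it))`.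
[folklore] -/
theorem hardyZ_neg_holds : hardyZ_neg := by
  intro t
  unfold hardyZ
  have h1 : (1 / 2 + ((-t : ℝ) : ℂ) * I) = conj (1 / 2 + (t : ℂ) * I) := by
    simp only [map_add, map_div₀, map_mul, Complex.conj_ofReal, Complex.conj_I, map_one,
      map_ofNat]
    push_cast
    ring
  have h2 : ((riemannSiegelTheta (-t) : ℝ) : ℂ) * I =
      conj ((riemannSiegelTheta t : ℂ) * I) := by
    rw [riemannSiegelTheta_neg_holds t]
    simp only [map_mul, Complex.conj_ofReal, Complex.conj_I]
    push_cast
    ring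
  rw [h1, h2, riemannZeta_conj, Complex.exp_conj, ← map_mul, Complex.conj_re]

/-! ## `θ` is real-analytic -/

/-- `ψ = Γ'/Γ` is analytic at every point of the open right half-plane (`Γ` analytic and zero-free
there). [folklore] -/
theorem analyticAt_digamma_of_re_pos {s : ℂ} (hs : 0 < s.re) : AnalyticAt ℂ Complex.digamma s := by
  have han := analyticAt_Gamma_of_re_pos hs
  rw [Complex.digamma_def]
  change AnalyticAt ℂ (fun z => deriv Complex.Gamma z / Complex.Gamma z) s
  exact han.deriv.div han (Complex.Gamma_ne_zero_of_re_pos hs)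

/-- The holomorphic extension `G(s) = ψ(1/4 + is/2)/2 − (log π)/2` of `θ'` to the half-plane
`Im s < 1/2`; for real `u`, `Re G(u) = θ'(u)`. [folklore] -/
theorem re_thetaDerivC_ofReal (u : ℝ) :
    (Complex.digamma (1 / 4 + (u : ℂ) / 2 * I) / 2 - Real.log π / 2).re =
      riemannSiegelThetaDeriv u := by
  rw [riemannSiegelThetaDeriv, Complex.sub_re, Complex.div_ofNat_re, Complex.div_ofNat_re,
    Complex.ofReal_re]

/-- `G(s) = ψ(1/4 + is/2)/2 − (log π)/2` is complex differentiable at every `s` with `Im s < 1/2`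
(there `Re (1/4 + is/2) = 1/4 − Im s/2 > 0`). [folklore] -/
theorem differentiableAt_thetaDerivC {s : ℂ} (hs : s.im < 1 / 2) :
    DifferentiableAt ℂ
      (fun s : ℂ => Complex.digamma (1 / 4 + s / 2 * I) / 2 - Real.log π / 2) s := by
  have hre : 0 < (1 / 4 + s / 2 * I).re := by
    simp only [Complex.add_re, Complex.mul_re, Complex.I_re, Complex.I_im, mul_zero, mul_one,
      zero_sub, Complex.div_ofNat_im]
    norm_num
    linarith
  have h1 : DifferentiableAt ℂ (fun s : ℂ => Complex.digamma (1 / 4 + s / 2 * I)) s :=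
    (analyticAt_digamma_of_re_pos hre).differentiableAt.comp s (by fun_prop)
  exact (h1.div_const 2).sub_const _

/-- **`θ` is real-analytic.** For every real `t₀`, `θ` is analytic at `t₀`: on the disc
`|s − t₀| < 1/2` the holomorphic `G` has a primitive `F` (Mathlib `DifferentiableOn.isExactOn_ball`,
Morera/Cauchy on a disc) with `F(t₀) = θ(t₀)`; `t ↦ Re F(t)` and `θ` have the same derivative
`θ' = Re G` on `(t₀ − 1/2, t₀ + 1/2)` and agree at `t₀`, hence agree on that interval, and
`t ↦ Re F(t)` is real-analytic as the real part of a holomorphic function along the real axis.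
(Edwards §6.5: `θ(t) = Im log Γ(1/4 + it/2) − (t/2) log π` is real-analytic.) [folklore] -/
theorem analyticAt_riemannSiegelTheta (t₀ : ℝ) : AnalyticAt ℝ riemannSiegelTheta t₀ := by
  set G : ℂ → ℂ := fun s => Complex.digamma (1 / 4 + s / 2 * I) / 2 - Real.log π / 2 with hG
  have hdiff : DifferentiableOn ℂ G (ball (t₀ : ℂ) (1 / 2)) := by
    intro s hs
    refine (differentiableAt_thetaDerivC ?_).differentiableWithinAt
    have h1 : |(s - t₀).im| < 1 / 2 :=
      (Complex.abs_im_le_norm _).trans_lt (by simpa [dist_eq_norm] using hs)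
    have h2 : (s - (t₀ : ℂ)).im = s.im := by simp
    rw [h2] at h1
    exact (abs_lt.1 h1).2
  obtain ⟨F, hF0, hF⟩ := hdiff.isExactOn_ball.with_val_at (t₀ : ℂ) (riemannSiegelTheta t₀ : ℂ)
  -- the real trace of `F`
  set f : ℝ → ℝ := fun t => (F t).re with hf
  have hmem : ∀ {t : ℝ}, t ∈ Ioo (t₀ - 1 / 2) (t₀ + 1 / 2) → (t : ℂ) ∈ ball (t₀ : ℂ) (1 / 2) := by
    intro t ht
    rw [mem_ball, dist_eq_norm, ← Complex.ofReal_sub, Complex.norm_real, Real.norm_eq_abs, abs_lt]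
    constructor <;> linarith [ht.1, ht.2]
  have hfd : ∀ t ∈ Ioo (t₀ - 1 / 2) (t₀ + 1 / 2), HasDerivAt f (riemannSiegelThetaDeriv t) t := by
    intro t ht
    have h1 : HasDerivAt (fun y : ℝ => F y) (G t) t := (hF _ (hmem ht)).comp_ofReal
    have h2 := (Complex.reCLM.hasFDerivAt.comp_hasDerivAt t h1)
    have h3 : Complex.reCLM (G t) = riemannSiegelThetaDeriv t := by
      rw [Complex.reCLM_apply, hG]
      exact re_thetaDerivC_ofReal t
    rw [h3] at h2
    exact h2
  -- `θ = f` on the interval: same derivative, same value at `t₀`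
  have heq : ∀ t ∈ Ioo (t₀ - 1 / 2) (t₀ + 1 / 2), riemannSiegelTheta t = f t := by
    intro t ht
    have ht₀ : t₀ ∈ Ioo (t₀ - 1 / 2) (t₀ + 1 / 2) := by constructor <;> linarith
    have hd : ∀ x ∈ Ioo (t₀ - 1 / 2) (t₀ + 1 / 2),
        HasDerivWithinAt (fun x => riemannSiegelTheta x - f x) 0
          (Ioo (t₀ - 1 / 2) (t₀ + 1 / 2)) x := by
      intro x hx
      have := (hasDerivAt_riemannSiegelTheta_holds x).sub (hfd x hx)
      rw [sub_self] at this
      exact this.hasDerivWithinAt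
    have key := (convex_Ioo (t₀ - 1 / 2) (t₀ + 1 / 2)).norm_image_sub_le_of_norm_hasDerivWithin_le
      (C := 0) hd (fun x _ => by simp) ht₀ ht
    have h0 : riemannSiegelTheta t₀ - f t₀ = 0 := by
      simp [hf, hF0]
    rw [h0, zero_mul, norm_le_zero_iff, sub_zero, sub_eq_zero] at key
    exact key
  -- `f` is real-analytic at `t₀`
  have hFdiff : DifferentiableOn ℂ F (ball (t₀ : ℂ) (1 / 2)) := fun z hz =>
    (hF z hz).differentiableAt.differentiableWithinAt
  have hFan : AnalyticAt ℂ F (t₀ : ℂ) :=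
    hFdiff.analyticOnNhd isOpen_ball _ (mem_ball_self (by norm_num))
  have hfan : AnalyticAt ℝ f t₀ := hFan.re_ofReal
  refine hfan.congr ?_
  have hnhds : Ioo (t₀ - 1 / 2) (t₀ + 1 / 2) ∈ 𝓝 t₀ :=
    Ioo_mem_nhds (by linarith) (by linarith)
  filter_upwards [hnhds] with t ht
  exact (heq t ht).symm

/-- **Discharge of the named fact `contDiff_riemannSiegelTheta`** (`RiemannSiegel.lean`): `θ` is
`C^n` for every `n : WithTop ℕ∞`, including `n = ω` (real-analytic), by
`analyticAt_riemannSiegelTheta` and `AnalyticOnNhd.contDiff`. (Edwards §6.5.) [folklore] -/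
theorem contDiff_riemannSiegelTheta_holds : contDiff_riemannSiegelTheta := by
  intro n
  have h : AnalyticOnNhd ℝ riemannSiegelTheta univ := fun t _ => analyticAt_riemannSiegelTheta t
  exact h.contDiff

end Literature.NumberTheory.LFunctions
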